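import Summits.ResolutionOfSingularities.ResolutionOfSingularities.Theorems.FrobeniusLadderFInjectiveMacaulayficationTStepGerm
import Literature.AlgebraicGeometry.Resolution.BlowupsScaling
import Literature.AlgebraicGeometry.Resolution.AffineBlowupIntegral
import Literature.AlgebraicGeometry.Resolution.AffineBlowupUnique
import Literature.AlgebraicGeometry.Resolution.AffineBlowupUniversal
import Literature.AlgebraicGeometry.Resolution.BlowupDisjointCentreSplitting
import Literature.AlgebraicGeometry.Resolution.BlowupsFlatBaseChange
import HarnessLib

/-!
# THE PRODUCT ROUTE TO A T″-INSTANCE: `Bl_{J·K} Spec A` regular, `K` cosupported at `x` ⇒ `TStepInstanceAt p x (J̃·𝒪_{X,x})`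
# (crux `FInjectiveMacaulayfication` stmt-ResolutionOfSingularities-15315, chain w45a, door v41.1; #3b «recurrent monoid habitat» of `Lines/T-I3b-spec.md`;
# seat res-L1-w45a-lead-1 g12)

[OURS · L1 W4.5a] Support file (`--supports stmt-ResolutionOfSingularities-15315 --as helper`); replaces the role of NO printed item; NOT a statement of any
manuscript; def-free; UNCONDITIONAL; no named fact. AI-written (AI review is weaker than expert review).

THE POINT. The T-side germ currency `TStepGerm.TStepInstanceAt p x I` (res-L1-w45a-stub-3, ✓p621847) asks, for the blowing ups `S′ → Spec 𝒪_{X,x}` along `I`, for ONE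
fibre-supported ideal `𝓚 ≠ ⊥` on `S′` all of whose blowing ups are regular. When `X = Spec A` is affine and the cure can be PULLED BACK FROM THE BASE — `𝓚 = K·𝒪_{X₁}` for an
ideal `K ⊆ A` cosupported at the point `x` — no chart analysis of the floor `X₁ = Bl_J Spec A` is needed at all: `Bl_{J·K} Spec A → Spec A` factors through `X₁` as a
blowing up along `K·𝒪_{X₁}` (Stacks 080A read backwards, tree `IsBlowup.exists_fac_of_mul`), so it suffices that the ONE affine blowing up `Bl_{J·K} Spec A` be a regular
scheme. This is the route by which the recurrent-monoid habitat (toric, 28 unimodular charts of `Bl_{J·K″}`) is settled with res-L1-w45c-stub-4's certificate engine.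

* ★ `tStepInstanceAt_of_product` — `A` a Noetherian domain, `x ∈ Spec A` a point with `x ≠ η`, `J ≠ ⊥`, `K ⊆ A` with `V(K) ⊆ {x}`, `Bl_{J·K} Spec A` regular
  ⇒ `TStepInstanceAt p x (J̃.comap (Spec A).fromSpecStalk x)` for every `p`. The binders of `TStepGerm.tStepInstanceAt_of_isBlowup`: `𝓚 := K̃.comap π₁` is supported over
  `x` (`support_comap`, `affineBlowup.support_idealSheaf`); it does not vanish on the local model `X₁ ×_X Spec 𝒪_{X,x}` because that model contains a point over the
  generic point `η ≠ x` (`affineBlowup.surjective`, Stacks 01J7 `range_pullback_fst_fromSpecStalk`) — the pattern of `E4GermSingularCentre.comap_pullback_fst_vanishingIdeal_ne_bot`.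
[folklore assembly; cite: StacksProject, Tag 080A; Tag 02OS; Tag 01J7] [cite: GortzWedhorn2020, Prop. 13.91 (2), Prop. 13.92]
-/

-- single-problem summit: the doubled namespace component is forced
set_option linter.dupNamespace false

noncomputable section

namespace Summit.ResolutionOfSingularities.ResolutionOfSingularities.Theorems.FInjectiveMacaulayfication.TStepOfProduct

open CategoryTheory CategoryTheory.Limits AlgebraicGeometry TopologicalSpace
open Literature.AlgebraicGeometry.Resolution
open Summit.ResolutionOfSingularities.ResolutionOfSingularities.Theorems.FInjectiveMacaulayfication

/-- ★ **THE PRODUCT ROUTE.** Let `A` be a Noetherian domain, `x ∈ Spec A` a point other than the generic point, `J ≠ ⊥` an ideal (the floor) and `K ⊆ A` an ideal whose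
zero locus is contained in `{x}` (the cure, pulled back from the base). If the affine blowing up `Bl_{J·K} Spec A` is a regular scheme, then `TStepInstanceAt p x (J̃·𝒪_{X,x})`
for every `p`: the floor `π₁ : Bl_J Spec A → Spec A`, the centre `𝓚 := K̃·𝒪_{Bl_J}` (supported over `x`, non-vanishing on the local model) and the factor
`Bl_{J·K} → Bl_J` of `Bl_{J·K} → Spec A` (a blowing up along `𝓚`, Stacks 080A) feed `TStepGerm.tStepInstanceAt_of_isBlowup`.
[OURS; folklore assembly; cite: StacksProject, Tag 080A, Tag 02OS, Tag 01J7; GortzWedhorn2020, Prop. 13.91 (2)] -/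
theorem tStepInstanceAt_of_product {A : Type} [CommRing A] [IsDomain A] [IsNoetherianRing A] (p : ℕ)
    (x : Spec (.of A)) (hx : x.asIdeal ≠ ⊥) (J K : Ideal A) (hJ : J ≠ ⊥)
    (hKx : ∀ y : Spec (.of A), y ∈ PrimeSpectrum.zeroLocus (K : Set A) → y = x)
    (hreg : Scheme.IsRegular (affineBlowup (J * K))) :
    TStepGerm.TStepInstanceAt p x ((affineBlowup.idealSheaf J).comap ((Spec (.of A)).fromSpecStalk x)) := by
  have hπ₁ : IsBlowup (affineBlowup.π J) (affineBlowup.idealSheaf J) := affineBlowup.isBlowup J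
  have hπ : IsBlowup (affineBlowup.π (J * K)) (affineBlowup.idealSheaf J * affineBlowup.idealSheaf K) := by
    rw [← affineBlowup.idealSheaf_mul]
    exact affineBlowup.isBlowup (J * K)
  obtain ⟨π₂, hπ₂, -⟩ := hπ.exists_fac_of_mul hπ₁
  -- the support of `K̃` is `{x}` (or empty)
  have hsuppK : ∀ y ∈ ((affineBlowup.idealSheaf K).support : Set ↥(Spec (.of A))), y = x := by
    intro y hy
    rw [affineBlowup.support_idealSheaf] at hy
    exact hKx y hy
  refine TStepGerm.tStepInstanceAt_of_isBlowup p x hπ₁ ((affineBlowup.idealSheaf K).comap (affineBlowup.π J)) ?_ ?_ hπ₂ fun x₂ _ => hreg x₂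
  · -- `h𝓚`: the pulled-back cure does not vanish on the local model — it misses a point over the generic point
    intro h0
    let η : Spec (.of A) := ⟨⊥, Ideal.isPrime_bot⟩
    obtain ⟨x₁, hx₁⟩ := affineBlowup.surjective hJ η
    have hηx : η ⤳ x := (PrimeSpectrum.le_iff_specializes η x).mp bot_le
    have hmem : x₁ ∈ Set.range (pullback.fst (affineBlowup.π J) ((Spec (.of A)).fromSpecStalk x)) := by
      rw [range_pullback_fst_fromSpecStalk]
      show (affineBlowup.π J).base x₁ ⤳ x
      rw [hx₁]
      exact hηx
    obtain ⟨t, rfl⟩ := hmem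
    have ht : t ∈ (((((affineBlowup.idealSheaf K).comap (affineBlowup.π J)).comap
        (pullback.fst (affineBlowup.π J) ((Spec (.of A)).fromSpecStalk x))).support : Set _)) := by
      rw [h0, Scheme.IdealSheafData.support_bot]; simp
    rw [Scheme.IdealSheafData.support_comap] at ht
    have ht' : (pullback.fst (affineBlowup.π J) ((Spec (.of A)).fromSpecStalk x)).base t ∈
        ((((affineBlowup.idealSheaf K).comap (affineBlowup.π J))).support : Set _) := ht
    rw [Scheme.IdealSheafData.support_comap] at ht'
    have ht'' : (affineBlowup.π J).base ((pullback.fst (affineBlowup.π J) ((Spec (.of A)).fromSpecStalk x)).base t) ∈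
        ((affineBlowup.idealSheaf K).support : Set _) := ht'
    have hηx' : η = x := by
      have := hsuppK _ ht''
      rwa [hx₁] at this
    exact hx (by rw [← hηx'])
  · -- `hsupp`: the centre is supported over `x`
    intro x₁ hx₁ _
    rw [Scheme.IdealSheafData.support_comap] at hx₁
    exact hsuppK _ hx₁

/-- The zero-locus hypothesis of `tStepInstanceAt_of_product` from an `𝔪`-primary-type certificate: if `x.asIdeal` is a maximal ideal all of whose members have a power in `K`
(e.g. `K` a monomial ideal containing a power of every monomial generator of the cone point), then `V(K) ⊆ {x}`. [folklore] -/
theorem zeroLocus_subset_of_pow_mem {A : Type} [CommRing A] (x : Spec (.of A)) (hmax : x.asIdeal.IsMaximal) (K : Ideal A)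
    {ι : Type} (g : ι → A) (hg : x.asIdeal = Ideal.span (Set.range g)) (hpow : ∀ i, ∃ n : ℕ, g i ^ n ∈ K) :
    ∀ y : Spec (.of A), y ∈ PrimeSpectrum.zeroLocus (K : Set A) → y = x := by
  intro y hy
  have hle : x.asIdeal ≤ y.asIdeal := by
    rw [hg, Ideal.span_le]
    rintro _ ⟨i, rfl⟩
    obtain ⟨n, hn⟩ := hpow i
    exact y.isPrime.mem_of_pow_mem n (hy hn)
  exact (PrimeSpectrum.ext (hmax.eq_of_le y.isPrime.ne_top hle)).symm

end Summit.ResolutionOfSingularities.ResolutionOfSingularities.Theorems.FInjectiveMacaulayfication.TStepOfProduct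

end
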